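import Literature.Analysis.SpecialFunctions.HypergeometricPolynomialOrthogonality
import Mathlib.Analysis.SpecialFunctions.Integrals.Basic
import HarnessLib

/-!
# Pointwise bounds for the hypergeometric polynomials `₂F₁(-n, n+1; c; z)` from the energy identity

Topic `Literature/Analysis/SpecialFunctions` (generic). Sequel of
`HypergeometricPolynomialOrthogonality.lean`; motivation: the eigenfunction expansion behind
`Literature.Probability.Percolation.LawlerSchrammWerner2002_hittingPDE` (LSW (2002), Lemma 2.2),
where termwise convergence of `Σ c_n e^{-λ_n t} y_n` and of its derivatives needs bounds on
`y_n = hypJacobi c n` growing at most polynomially in `n` relative to the `L²(ρ)`-norms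
`h_n = ∫₀¹ ρ y_n²`. No asymptotics of Jacobi polynomials are used: for `1 < c < 2` and
`0 < a < 1` we prove, with constants depending only on `c, a` (and `b`),

* `(y_n(z))² ≤ K (n+1)² h_n` for `z ∈ [a, 1]` — from `y_n(z) - y_n(z') = ∫ y_n'`,
  Cauchy–Schwarz with the weight `1/P`, `P = z^c (1-z)^{2-c}` (`∫_a^1 1/P < ∞` because
  `c - 2 > -1`), the energy identity `∫₀¹ P (y_n')² = n(n+1) h_n`, and a point
  `z' ∈ [a, (1+a)/2]` where `ρ y_n²` does not exceed its mean;
* `(y_n'(z))² ≤ K (n+1)⁶ h_n` for `z ∈ [a, 1)` — from `P(z) y_n'(z) = n(n+1) ∫_z^1 ρ y_n`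
  (the self-adjoint form of Euler's equation integrated from `z` to `1`, `P(1) = 0`) and
  `∫_z^1 ρ ≤ (1-z)^{2-c}/(2-c)`, `P(z) ≥ a^c (1-z)^{2-c}`;
* `(y_n''(z))² ≤ K (n+1)⁶ h_n` for `z ∈ [a, b]`, `b < 1` — from the equation itself.

## Contents

* `sq_integral_mul_mul_le` — weighted Cauchy–Schwarz for interval integrals;
* `hypJacobiNormSq c n = ∫₀¹ ρ y_n²` (`h_n`) and its positivity;
* `jacobiFlux_mul_derivative_hypJacobi` — `P y_n' = n(n+1) ∫_·^1 ρ y_n`;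
* `exists_sq_hypJacobi_le`, `exists_sq_derivative_hypJacobi_le`,
  `exists_sq_derivative_derivative_hypJacobi_le`;
* near `z = 0`: `integral_inv_jacobiFlux_le` (`∫_z^1 1/P ≤ 6 z^{1-c}/(c-1)`),
  `exists_sq_hypJacobi_le_near_zero` (`y_n(z)² ≤ K (n+1)² h_n z^{1-c}` on `(0, 1/2]`).

## References

* G. E. Andrews, R. Askey, R. Roy, *Special Functions*, CUP (1999): (2.3.5), (2.5.14).
  [AndrewsAskeyRoy1999]
* G. F. Lawler, O. Schramm, W. Werner, *One-arm exponent for critical 2D percolation*, Electron.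
  J. Probab. 7 (2002), no. 2, Lemma 2.2. [LawlerSchrammWernerEJP2002]
-/

noncomputable section

open Polynomial Set MeasureTheory intervalIntegral Filter
open scoped Topology

namespace Literature.Analysis.SpecialFunctions

/-! ### Weighted Cauchy–Schwarz for interval integrals -/

/-- **Weighted Cauchy–Schwarz** for interval integrals of real functions: for `a ≤ b` and a
weight `w ≥ 0` on `[a, b]`, `(∫_a^b f g w)² ≤ (∫_a^b f² w) (∫_a^b g² w)` (discriminant of
`t ↦ ∫ (f - t g)² w ≥ 0`). [folklore] -/
theorem sq_integral_mul_mul_le {f g w : ℝ → ℝ} {a b : ℝ} (hab : a ≤ b)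
    (hw : ∀ x ∈ Icc a b, 0 ≤ w x)
    (hf : IntervalIntegrable (fun x => f x ^ 2 * w x) volume a b)
    (hg : IntervalIntegrable (fun x => g x ^ 2 * w x) volume a b)
    (hfg : IntervalIntegrable (fun x => f x * g x * w x) volume a b) :
    (∫ x in a..b, f x * g x * w x) ^ 2 ≤
      (∫ x in a..b, f x ^ 2 * w x) * ∫ x in a..b, g x ^ 2 * w x := by
  set A := ∫ x in a..b, f x ^ 2 * w x
  set B := ∫ x in a..b, f x * g x * w x
  set C := ∫ x in a..b, g x ^ 2 * w x
  have hC : 0 ≤ C :=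
    intervalIntegral.integral_nonneg hab fun x hx => mul_nonneg (sq_nonneg _) (hw x hx)
  have key : ∀ t : ℝ, 0 ≤ A - 2 * t * B + t ^ 2 * C := by
    intro t
    have h2 : 0 ≤ ∫ x in a..b, (f x - t * g x) ^ 2 * w x :=
      intervalIntegral.integral_nonneg hab fun x hx => mul_nonneg (sq_nonneg _) (hw x hx)
    have h3 : ∫ x in a..b, (f x - t * g x) ^ 2 * w x = A - 2 * t * B + t ^ 2 * C := by
      have e : ∀ x, (f x - t * g x) ^ 2 * w x
          = (f x ^ 2 * w x - 2 * t * (f x * g x * w x)) + t ^ 2 * (g x ^ 2 * w x) :=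
        fun x => by ring
      simp_rw [e]
      rw [intervalIntegral.integral_add (hf.sub (hfg.const_mul _)) (hg.const_mul _),
        intervalIntegral.integral_sub hf (hfg.const_mul _), intervalIntegral.integral_const_mul,
        intervalIntegral.integral_const_mul]
    linarith
  rcases hC.eq_or_lt with hC0 | hCpos
  · have hB : B = 0 := by
      by_contra hB
      have h := key ((A + 1) / (2 * B))
      rw [← hC0, mul_zero, add_zero] at h
      have : 2 * ((A + 1) / (2 * B)) * B = A + 1 := by field_simp
      linarith
    have hA : 0 ≤ A :=
      intervalIntegral.integral_nonneg hab fun x hx => mul_nonneg (sq_nonneg _) (hw x hx)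
    rw [hB, ← hC0]
    simp
  · have h := key (B / C)
    have : A - 2 * (B / C) * B + (B / C) ^ 2 * C = A - B ^ 2 / C := by field_simp; ring
    rw [this, sub_nonneg, div_le_iff₀ hCpos] at h
    linarith

/-! ### The norms `h_n` -/

/-- `h_n = ∫₀¹ ρ y_n²`, the squared `L²(ρ)`-norm of `y_n = ₂F₁(-n, n+1; c; ·)`. [folklore] -/
def hypJacobiNormSq (c : ℝ) (n : ℕ) : ℝ :=
  ∫ z in (0 : ℝ)..1, jacobiWeight c z * ((hypJacobi c n).eval z) ^ 2

/-- `h_n > 0` (`1 < c < 2`). [folklore] -/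
theorem hypJacobiNormSq_pos {c : ℝ} (hc : 1 < c) (hc2 : c < 2) (n : ℕ) :
    0 < hypJacobiNormSq c n :=
  integral_jacobiWeight_hypJacobi_sq_pos hc hc2 n

/-- `∫_z^1 (1-y)^{1-c} dy = (1-z)^{2-c}/(2-c)` (`c < 2`; for `z > 1` both sides carry
`Real.rpow` junk values consistently). [folklore] -/
theorem integral_one_sub_rpow {c : ℝ} (hc2 : c < 2) (z : ℝ) :
    ∫ y in z..1, (1 - y) ^ (1 - c) = (1 - z) ^ (2 - c) / (2 - c) := by
  rw [intervalIntegral.integral_comp_sub_left (fun y : ℝ => y ^ (1 - c)) 1, sub_self,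
    integral_rpow (Or.inl (by linarith)), show (1 : ℝ) - c + 1 = 2 - c by ring,
    Real.zero_rpow (by linarith), sub_zero]

/-- `1/P ≥ 0` on `[0, 1]` (including the junk value `0⁻¹ = 0` at the endpoints). [folklore] -/
theorem inv_jacobiFlux_nonneg (c : ℝ) {z : ℝ} (hz : z ∈ Icc (0 : ℝ) 1) :
    0 ≤ (jacobiFlux c z)⁻¹ :=
  inv_nonneg.2 (jacobiFlux_nonneg c hz)

section Bounds

variable {c : ℝ} (hc : 1 < c) (hc2 : c < 2)
include hc hc2

/-! ### Elementary bounds on `ρ` and `P` -/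

/-- `ρ(y) ≤ (1-y)^{1-c}` on `[0, 1]` (`y^{c-1} ≤ 1`). [folklore] -/
theorem jacobiWeight_le {y : ℝ} (hy : y ∈ Icc (0 : ℝ) 1) :
    jacobiWeight c y ≤ (1 - y) ^ (1 - c) := by
  unfold jacobiWeight
  have h1 : y ^ (c - 1) ≤ 1 := Real.rpow_le_one hy.1 hy.2 (by linarith)
  have h2 : 0 ≤ (1 - y) ^ (1 - c) := Real.rpow_nonneg (by linarith [hy.2]) _
  nlinarith

/-- `ρ(y) ≥ a^{c-1}` on `[a, b]` when `0 < a` and `b < 1` (`(1-y)^{1-c} ≥ 1`). [folklore] -/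
theorem le_jacobiWeight {a b y : ℝ} (ha : 0 < a) (hb : b < 1) (hy : y ∈ Icc a b) :
    a ^ (c - 1) ≤ jacobiWeight c y := by
  unfold jacobiWeight
  have h1 : a ^ (c - 1) ≤ y ^ (c - 1) := Real.rpow_le_rpow ha.le hy.1 (by linarith)
  have h2 : 1 ≤ (1 - y) ^ (1 - c) :=
    Real.one_le_rpow_of_pos_of_le_one_of_nonpos (by linarith [hy.2]) (by linarith [hy.1])
      (by linarith)
  have h3 : 0 ≤ y ^ (c - 1) := Real.rpow_nonneg (ha.le.trans hy.1) _
  nlinarith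

/-- `P(z) ≥ a^c (1-z)^{2-c}` on `[a, 1]` (`0 ≤ a`). [folklore] -/
theorem le_jacobiFlux {a z : ℝ} (ha : 0 ≤ a) (hz : z ∈ Icc a 1) :
    a ^ c * (1 - z) ^ (2 - c) ≤ jacobiFlux c z := by
  unfold jacobiFlux
  exact mul_le_mul_of_nonneg_right (Real.rpow_le_rpow ha hz.1 (by linarith))
    (Real.rpow_nonneg (by linarith [hz.2]) _)

/-- `∫_z^1 ρ ≤ (1-z)^{2-c}/(2-c)` for `z ∈ [0, 1]`. [folklore] -/
theorem integral_jacobiWeight_le {z : ℝ} (hz : z ∈ Icc (0 : ℝ) 1) :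
    ∫ y in z..1, jacobiWeight c y ≤ (1 - z) ^ (2 - c) / (2 - c) := by
  rw [← integral_one_sub_rpow hc2 z]
  have hi1 : IntervalIntegrable (jacobiWeight c) volume z 1 :=
    (intervalIntegrable_jacobiWeight hc.le hc2).mono_set (by
      rw [uIcc_of_le hz.2, uIcc_of_le zero_le_one]; exact Icc_subset_Icc hz.1 le_rfl)
  have hi2 : IntervalIntegrable (fun y : ℝ => (1 - y) ^ (1 - c)) volume z 1 :=
    (intervalIntegrable_one_sub_rpow hc2).mono_set (by
      rw [uIcc_of_le hz.2, uIcc_of_le zero_le_one]; exact Icc_subset_Icc hz.1 le_rfl)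
  exact intervalIntegral.integral_mono_on hz.2 hi1 hi2 fun y hy =>
    jacobiWeight_le hc hc2 ⟨hz.1.trans hy.1, hy.2⟩

/-! ### The inverse flux `1/P` on `[a, 1]` -/

omit hc2 in
/-- `1/P = z^{-c} (1-z)^{c-2}` is integrable on `[a, 1]` for `0 < a` (`c - 2 > -1`). [folklore] -/
theorem intervalIntegrable_inv_jacobiFlux {a : ℝ} (ha : 0 < a) (ha1 : a ≤ 1) :
    IntervalIntegrable (fun z => (jacobiFlux c z)⁻¹) volume a 1 := by
  have h1 : IntervalIntegrable (fun z : ℝ => (1 - z) ^ (c - 2)) volume a 1 := by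
    have h := (intervalIntegral.intervalIntegrable_rpow' (a := 1 - a) (b := 0) (r := c - 2)
      (by linarith)).comp_sub_left 1
    simpa using h
  have h2 : ContinuousOn (fun z : ℝ => z ^ (-c)) (uIcc a 1) := by
    refine ContinuousOn.rpow_const continuousOn_id fun z hz => Or.inl ?_
    rw [uIcc_of_le ha1] at hz
    exact (ha.trans_le hz.1).ne'
  refine (h1.continuousOn_mul h2).congr ?_
  rw [uIoc_of_le ha1]
  intro z hz
  have hz0 : 0 < z := ha.trans hz.1
  show z ^ (-c) * (1 - z) ^ (c - 2) = (jacobiFlux c z)⁻¹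
  rw [jacobiFlux, mul_inv, Real.rpow_neg hz0.le, show c - 2 = -(2 - c) by ring,
    Real.rpow_neg (by linarith [hz.2])]

/-! ### The sup bound on `[a, 1]` -/

/-- The increment bound: for `0 < a ≤ z' ≤ z < 1`,
`(y_n(z) - y_n(z'))² ≤ n(n+1) h_n · ∫_a^1 1/P` (weighted Cauchy–Schwarz and the energy identity).
[folklore] -/
theorem sq_hypJacobi_sub_le {a : ℝ} (ha : 0 < a) (n : ℕ) {z' z : ℝ} (hz' : a ≤ z')
    (hzz : z' ≤ z) (hz1 : z < 1) :
    ((hypJacobi c n).eval z - (hypJacobi c n).eval z') ^ 2 ≤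
      (n : ℝ) * (n + 1) * hypJacobiNormSq c n * ∫ y in a..1, (jacobiFlux c y)⁻¹ := by
  have ha1 : a ≤ 1 := hz'.trans (hzz.trans hz1.le)
  set q := hypJacobi c n with hq
  have hPc := continuous_jacobiFlux (by linarith : 0 < c) hc2
  have hq'c := (Polynomial.differentiable (𝕜 := ℝ) (derivative q)).continuous
  have hsub : Icc z' z ⊆ Ioo 0 1 :=
    fun y hy => ⟨ha.trans_le (hz'.trans hy.1), hy.2.trans_lt hz1⟩
  have hPpos : ∀ y ∈ Icc z' z, 0 < jacobiFlux c y := fun y hy => jacobiFlux_pos c (hsub hy)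
  -- `y(z) - y(z') = ∫_{z'}^z y' = ∫_{z'}^z (P y') · 1 · (1/P)`
  have hftc : ∫ y in z'..z, (derivative q).eval y = q.eval z - q.eval z' :=
    intervalIntegral.integral_eq_sub_of_hasDerivAt (fun y _ => Polynomial.hasDerivAt q y)
      (hq'c.intervalIntegrable _ _)
  have heq : ∫ y in z'..z, (derivative q).eval y =
      ∫ y in z'..z, jacobiFlux c y * (derivative q).eval y * 1 * (jacobiFlux c y)⁻¹ := by
    refine intervalIntegral.integral_congr fun y hy => ?_
    rw [uIcc_of_le hzz] at hy
    have := (hPpos y hy).ne'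
    field_simp
  -- Cauchy–Schwarz with weight `1/P`
  have hcontinv : ContinuousOn (fun y => (jacobiFlux c y)⁻¹) (Icc z' z) :=
    hPc.continuousOn.inv₀ fun y hy => (hPpos y hy).ne'
  have hF : IntervalIntegrable
      (fun y => (jacobiFlux c y * (derivative q).eval y) ^ 2 * (jacobiFlux c y)⁻¹)
      volume z' z :=
    ContinuousOn.intervalIntegrable_of_Icc hzz
      (((hPc.mul hq'c).pow 2).continuousOn.mul hcontinv)
  have hG : IntervalIntegrable (fun y => (1 : ℝ) ^ 2 * (jacobiFlux c y)⁻¹) volume z' z :=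
    ContinuousOn.intervalIntegrable_of_Icc hzz (continuousOn_const.mul hcontinv)
  have hFG : IntervalIntegrable
      (fun y => jacobiFlux c y * (derivative q).eval y * 1 * (jacobiFlux c y)⁻¹) volume z' z :=
    ContinuousOn.intervalIntegrable_of_Icc hzz
      ((((hPc.mul hq'c).mul continuous_const).continuousOn).mul hcontinv)
  have hCS := sq_integral_mul_mul_le hzz (fun y hy => inv_jacobiFlux_nonneg c
    ⟨(hsub hy).1.le, (hsub hy).2.le⟩) hF hG hFG
  -- the two factors
  have h1 : ∫ y in z'..z, (jacobiFlux c y * (derivative q).eval y) ^ 2 * (jacobiFlux c y)⁻¹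
      ≤ (n : ℝ) * (n + 1) * hypJacobiNormSq c n := by
    have e1 : ∫ y in z'..z, (jacobiFlux c y * (derivative q).eval y) ^ 2 * (jacobiFlux c y)⁻¹
        = ∫ y in z'..z, jacobiFlux c y * ((derivative q).eval y) ^ 2 := by
      refine intervalIntegral.integral_congr fun y hy => ?_
      rw [uIcc_of_le hzz] at hy
      have := (hPpos y hy).ne'
      field_simp
    rw [e1, hypJacobiNormSq, ← integral_jacobiFlux_derivative_sq hc hc2 n]
    refine intervalIntegral.integral_mono_interval (ha.le.trans hz') hzz hz1.le ?_ ?_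
    · filter_upwards [ae_restrict_mem measurableSet_Ioc] with y hy
      exact mul_nonneg (jacobiFlux_nonneg c ⟨hy.1.le, hy.2⟩) (sq_nonneg _)
    · exact (hPc.mul (hq'c.pow 2)).intervalIntegrable 0 1
  have h2 : ∫ y in z'..z, (1 : ℝ) ^ 2 * (jacobiFlux c y)⁻¹ ≤ ∫ y in a..1, (jacobiFlux c y)⁻¹ := by
    simp only [one_pow, one_mul]
    refine intervalIntegral.integral_mono_interval hz' hzz hz1.le ?_
      (intervalIntegrable_inv_jacobiFlux hc ha ha1)
    filter_upwards [ae_restrict_mem measurableSet_Ioc] with y hy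
    exact inv_jacobiFlux_nonneg c ⟨(ha.trans hy.1).le, hy.2⟩
  have h0 : 0 ≤ ∫ y in z'..z, (jacobiFlux c y * (derivative q).eval y) ^ 2 * (jacobiFlux c y)⁻¹ :=
    intervalIntegral.integral_nonneg hzz fun y hy =>
      mul_nonneg (sq_nonneg _) (inv_jacobiFlux_nonneg c ⟨(hsub hy).1.le, (hsub hy).2.le⟩)
  have h0' : 0 ≤ ∫ y in z'..z, (1 : ℝ) ^ 2 * (jacobiFlux c y)⁻¹ :=
    intervalIntegral.integral_nonneg hzz fun y hy =>
      mul_nonneg (sq_nonneg _) (inv_jacobiFlux_nonneg c ⟨(hsub hy).1.le, (hsub hy).2.le⟩)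
  rw [← hftc, heq]
  calc _ ≤ _ := hCS
    _ ≤ ((n : ℝ) * (n + 1) * hypJacobiNormSq c n) * ∫ y in a..1, (jacobiFlux c y)⁻¹ :=
        mul_le_mul h1 h2 h0' (by positivity [hypJacobiNormSq_pos hc hc2 n])

/-- A point where `ρ y_n²` does not exceed its mean: for `0 < a < b < 1` there is
`z' ∈ [a, b]` with `y_n(z')² ≤ h_n / ((b - a) a^{c-1})`. [folklore] -/
theorem exists_sq_hypJacobi_le_mean {a b : ℝ} (ha : 0 < a) (hab : a < b) (hb : b < 1) (n : ℕ) :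
    ∃ z' ∈ Icc a b, ((hypJacobi c n).eval z') ^ 2 ≤
      hypJacobiNormSq c n / ((b - a) * a ^ (c - 1)) := by
  set f : ℝ → ℝ := fun y => jacobiWeight c y * ((hypJacobi c n).eval y) ^ 2 with hf
  have hqc := continuous_hypJacobi_eval c n
  have hρc : ContinuousOn (jacobiWeight c) (Icc a b) := by
    intro y hy
    have hy0 : 0 < y := ha.trans_le hy.1
    have hy1 : 0 < 1 - y := by linarith [hy.2]
    exact (((continuousAt_id.rpow_const (Or.inl hy0.ne')).mul
      ((continuousAt_const.sub continuousAt_id).rpow_const (Or.inl hy1.ne')))).continuousWithinAt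
  have hfc : ContinuousOn f (Icc a b) := hρc.mul (hqc.pow 2).continuousOn
  obtain ⟨z', hz', hmin⟩ := IsCompact.exists_isMinOn (α := ℝ) isCompact_Icc
    (nonempty_Icc.2 hab.le) hfc
  refine ⟨z', hz', ?_⟩
  -- `(b - a) f(z') ≤ ∫_a^b f ≤ ∫_0^1 f = h_n`
  have hfi : IntervalIntegrable f volume 0 1 :=
    intervalIntegrable_jacobiWeight_mul hc.le hc2 (hqc.pow 2)
  have hfi' : IntervalIntegrable f volume a b :=
    hfi.mono_set (by
      rw [uIcc_of_le hab.le, uIcc_of_le zero_le_one]; exact Icc_subset_Icc ha.le hb.le)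
  have h1 : (b - a) * f z' ≤ ∫ y in a..b, f y := by
    have := intervalIntegral.integral_mono_on hab.le intervalIntegrable_const hfi'
      (fun y hy => show (fun _ => f z') y ≤ f y from hmin hy)
    simpa [intervalIntegral.integral_const, smul_eq_mul] using this
  have h2 : ∫ y in a..b, f y ≤ hypJacobiNormSq c n := by
    refine intervalIntegral.integral_mono_interval ha.le hab.le hb.le ?_ hfi
    filter_upwards [ae_restrict_mem measurableSet_Ioc] with y hy
    exact mul_nonneg (jacobiWeight_nonneg c ⟨hy.1.le, hy.2⟩) (sq_nonneg _)
  have hρ : a ^ (c - 1) ≤ jacobiWeight c z' := le_jacobiWeight hc hc2 ha hb hz'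
  have hac : 0 < a ^ (c - 1) := Real.rpow_pos_of_pos ha _
  have hba : 0 < b - a := by linarith
  rw [le_div_iff₀ (mul_pos hba hac)]
  have hq2 : 0 ≤ ((hypJacobi c n).eval z') ^ 2 := sq_nonneg _
  calc ((hypJacobi c n).eval z') ^ 2 * ((b - a) * a ^ (c - 1))
        = (b - a) * (a ^ (c - 1) * ((hypJacobi c n).eval z') ^ 2) := by ring
    _ ≤ (b - a) * f z' := by
        refine mul_le_mul_of_nonneg_left ?_ hba.le
        exact mul_le_mul_of_nonneg_right hρ hq2
    _ ≤ hypJacobiNormSq c n := h1.trans h2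

/-- **Sup bound**: for `0 < a < 1` there is `K > 0` (depending on `c, a`) with
`y_n(z)² ≤ K (n+1)² h_n` for all `n` and all `z ∈ [a, 1]`. [folklore] -/
theorem exists_sq_hypJacobi_le {a : ℝ} (ha : 0 < a) (ha1 : a < 1) :
    ∃ K : ℝ, 0 < K ∧ ∀ n : ℕ, ∀ z ∈ Icc a 1,
      ((hypJacobi c n).eval z) ^ 2 ≤ K * ((n : ℝ) + 1) ^ 2 * hypJacobiNormSq c n := by
  set b := (1 + a) / 2 with hb
  have hab : a < b := by rw [hb]; linarith
  have hb1 : b < 1 := by rw [hb]; linarith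
  set I := ∫ y in a..1, (jacobiFlux c y)⁻¹ with hI
  have hI0 : 0 ≤ I := intervalIntegral.integral_nonneg ha1.le fun y hy =>
    inv_jacobiFlux_nonneg c ⟨ha.le.trans hy.1, hy.2⟩
  set D := (b - a) * a ^ (c - 1) with hD
  have hD0 : 0 < D := mul_pos (by linarith) (Real.rpow_pos_of_pos ha _)
  refine ⟨2 * I + 2 / D + 1, by positivity, fun n => ?_⟩
  have hh := hypJacobiNormSq_pos hc hc2 n
  set h := hypJacobiNormSq c n
  obtain ⟨z', hz', hsmall⟩ := exists_sq_hypJacobi_le_mean hc hc2 ha hab hb1 n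
  -- the bound on `[a, 1)`
  have main : ∀ z ∈ Ico a 1,
      ((hypJacobi c n).eval z) ^ 2 ≤ (2 * I + 2 / D + 1) * ((n : ℝ) + 1) ^ 2 * h := by
    intro z hz
    have hincr : ((hypJacobi c n).eval z - (hypJacobi c n).eval z') ^ 2 ≤
        (n : ℝ) * (n + 1) * h * I := by
      rcases le_total z' z with hle | hle
      · exact sq_hypJacobi_sub_le hc hc2 ha n hz'.1 hle hz.2
      · rw [← neg_sub, neg_sq]
        exact sq_hypJacobi_sub_le hc hc2 ha n hz.1 hle (hz'.2.trans_lt hb1)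
    have e : (hypJacobi c n).eval z =
        ((hypJacobi c n).eval z - (hypJacobi c n).eval z') + (hypJacobi c n).eval z' := by ring
    have hsq : ((hypJacobi c n).eval z) ^ 2 ≤
        2 * ((hypJacobi c n).eval z - (hypJacobi c n).eval z') ^ 2
          + 2 * ((hypJacobi c n).eval z') ^ 2 := by
      rw [e]; nlinarith [sq_nonneg (((hypJacobi c n).eval z - (hypJacobi c n).eval z')
        - (hypJacobi c n).eval z')]
    have hn : (n : ℝ) * (n + 1) ≤ ((n : ℝ) + 1) ^ 2 := by nlinarith
    have hn1 : (1 : ℝ) ≤ ((n : ℝ) + 1) ^ 2 := by nlinarith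
    have hsmall' : ((hypJacobi c n).eval z') ^ 2 ≤ h / D := hsmall
    calc ((hypJacobi c n).eval z) ^ 2
          ≤ 2 * ((n : ℝ) * (n + 1) * h * I) + 2 * (h / D) := by linarith
      _ ≤ 2 * (((n : ℝ) + 1) ^ 2 * h * I) + 2 * (h / D) * ((n : ℝ) + 1) ^ 2 := by
          have h3 : 0 ≤ h / D := div_nonneg hh.le hD0.le
          nlinarith [mul_le_mul_of_nonneg_right hn (mul_nonneg hh.le hI0)]
      _ ≤ (2 * I + 2 / D + 1) * ((n : ℝ) + 1) ^ 2 * h := by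
          have : 2 * (h / D) * ((n : ℝ) + 1) ^ 2 = 2 / D * ((n : ℝ) + 1) ^ 2 * h := by ring
          rw [this]; nlinarith
  -- extension to `z = 1` by continuity
  intro z hz
  rcases hz.2.lt_or_eq with hlt | heq
  · exact main z ⟨hz.1, hlt⟩
  · have hclosed : IsClosed {y : ℝ | ((hypJacobi c n).eval y) ^ 2 ≤
        (2 * I + 2 / D + 1) * ((n : ℝ) + 1) ^ 2 * h} :=
      isClosed_le ((continuous_hypJacobi_eval c n).pow 2) continuous_const
    have hsub : Ico a 1 ⊆ {y : ℝ | ((hypJacobi c n).eval y) ^ 2 ≤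
        (2 * I + 2 / D + 1) * ((n : ℝ) + 1) ^ 2 * h} := main
    have := (hclosed.closure_subset_iff.2 hsub)
    rw [closure_Ico ha1.ne] at this
    exact this hz

/-! ### The derivative bound on `[a, 1)` -/

/-- **The integrated self-adjoint equation**: `P(z) y_n'(z) = n(n+1) ∫_z^1 ρ y_n` for `z ∈ [0, 1]`
(FTC for `P y_n'` on `[z, 1]`, `(P y_n')' = -n(n+1) ρ y_n`, `P(1) = 0`). [folklore] -/
theorem jacobiFlux_mul_derivative_hypJacobi (n : ℕ) {z : ℝ} (hz : z ∈ Icc (0 : ℝ) 1) :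
    jacobiFlux c z * (derivative (hypJacobi c n)).eval z =
      (n : ℝ) * (n + 1) * ∫ y in z..1, jacobiWeight c y * (hypJacobi c n).eval y := by
  set q := hypJacobi c n with hq
  have hck : ∀ k : ℕ, k < n → (k : ℝ) + c ≠ 0 := fun k _ => by positivity
  have hPc := continuous_jacobiFlux (by linarith : 0 < c) hc2
  have hq'c := (Polynomial.differentiable (𝕜 := ℝ) (derivative q)).continuous
  have hqc := (Polynomial.differentiable (𝕜 := ℝ) q).continuous
  have hcont : ContinuousOn (fun y => jacobiFlux c y * (derivative q).eval y) (Icc z 1) :=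
    (hPc.mul hq'c).continuousOn
  have hderiv : ∀ y ∈ Ioo z 1, HasDerivAt (fun y => jacobiFlux c y * (derivative q).eval y)
      (-((n : ℝ) * (n + 1)) * (jacobiWeight c y * q.eval y)) y := by
    intro y hy
    have hy' : y ∈ Ioo (0 : ℝ) 1 := ⟨hz.1.trans_lt hy.1, hy.2⟩
    have h := (hasDerivAt_jacobiFlux c hy').mul (Polynomial.hasDerivAt (derivative q) y)
    refine h.congr_deriv ?_
    rw [jacobiFlux_eq hc hc2 (Ioo_subset_Icc_self hy')]
    have hode := hypJacobi_ode_eval n hck y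
    rw [← hq] at hode
    linear_combination (jacobiWeight c y) * hode
  have hint : IntervalIntegrable (fun y => -((n : ℝ) * (n + 1)) * (jacobiWeight c y * q.eval y))
      volume z 1 :=
    ((intervalIntegrable_jacobiWeight_mul hc.le hc2 hqc).mono_set (by
      rw [uIcc_of_le hz.2, uIcc_of_le zero_le_one]; exact Icc_subset_Icc hz.1 le_rfl)).const_mul _
  have hftc := intervalIntegral.integral_eq_sub_of_hasDerivAt_of_le hz.2 hcont hderiv hint
  rw [jacobiFlux_one (by linarith : c ≠ 2), zero_mul, zero_sub,
    intervalIntegral.integral_const_mul] at hftc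
  linarith

/-- **Derivative bound**: for `0 < a < 1` there is `K > 0` (depending on `c, a`) with
`y_n'(z)² ≤ K (n+1)⁶ h_n` for all `n` and all `z ∈ [a, 1)`. [folklore] -/
theorem exists_sq_derivative_hypJacobi_le {a : ℝ} (ha : 0 < a) (ha1 : a < 1) :
    ∃ K : ℝ, 0 < K ∧ ∀ n : ℕ, ∀ z ∈ Ico a 1,
      ((derivative (hypJacobi c n)).eval z) ^ 2 ≤
        K * ((n : ℝ) + 1) ^ 6 * hypJacobiNormSq c n := by
  obtain ⟨K, hK, hsup⟩ := exists_sq_hypJacobi_le hc hc2 ha ha1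
  have h2c : 0 < 2 - c := by linarith
  have hac : 0 < a ^ c := Real.rpow_pos_of_pos ha _
  refine ⟨K / ((2 - c) ^ 2 * (a ^ c) ^ 2), by positivity, fun n z hz => ?_⟩
  set q := hypJacobi c n with hq
  have hh := hypJacobiNormSq_pos hc hc2 n
  set h := hypJacobiNormSq c n
  have hqc := (Polynomial.differentiable (𝕜 := ℝ) q).continuous
  -- `|y_n| ≤ M` on `[z, 1]`
  set M := Real.sqrt (K * h) * ((n : ℝ) + 1) with hM
  have hM0 : 0 ≤ M := by positivity
  have hM2 : M ^ 2 = K * ((n : ℝ) + 1) ^ 2 * h := by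
    rw [hM, mul_pow, Real.sq_sqrt (by positivity)]; ring
  have habs : ∀ y ∈ Icc z 1, |q.eval y| ≤ M := by
    intro y hy
    have h2 : (q.eval y) ^ 2 ≤ M ^ 2 := by rw [hM2]; exact hsup n y ⟨hz.1.trans hy.1, hy.2⟩
    exact abs_le_of_sq_le_sq h2 hM0
  -- `|P(z) y'(z)| ≤ n(n+1) M (1-z)^{2-c}/(2-c)`
  have hz01 : z ∈ Icc (0 : ℝ) 1 := ⟨ha.le.trans hz.1, hz.2.le⟩
  have hPq := jacobiFlux_mul_derivative_hypJacobi hc hc2 n hz01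
  rw [← hq] at hPq
  have hiρ : IntervalIntegrable (jacobiWeight c) volume z 1 :=
    (intervalIntegrable_jacobiWeight hc.le hc2).mono_set (by
      rw [uIcc_of_le hz.2.le, uIcc_of_le zero_le_one]; exact Icc_subset_Icc hz01.1 le_rfl)
  have hiρq : IntervalIntegrable (fun y => jacobiWeight c y * q.eval y) volume z 1 :=
    hiρ.mul_continuousOn hqc.continuousOn
  have hint_abs : |∫ y in z..1, jacobiWeight c y * q.eval y| ≤ M * ((1 - z) ^ (2 - c) / (2 - c)) := by
    calc |∫ y in z..1, jacobiWeight c y * q.eval y|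
          ≤ ∫ y in z..1, |jacobiWeight c y * q.eval y| :=
            intervalIntegral.abs_integral_le_integral_abs hz.2.le
      _ ≤ ∫ y in z..1, M * jacobiWeight c y := by
          refine intervalIntegral.integral_mono_on hz.2.le hiρq.abs (hiρ.const_mul M) ?_
          intro y hy
          rw [abs_mul, abs_of_nonneg (jacobiWeight_nonneg c ⟨hz01.1.trans hy.1, hy.2⟩), mul_comm]
          exact mul_le_mul_of_nonneg_right (habs y hy)
            (jacobiWeight_nonneg c ⟨hz01.1.trans hy.1, hy.2⟩)
      _ = M * ∫ y in z..1, jacobiWeight c y := intervalIntegral.integral_const_mul _ _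
      _ ≤ M * ((1 - z) ^ (2 - c) / (2 - c)) :=
          mul_le_mul_of_nonneg_left (integral_jacobiWeight_le hc hc2 hz01) hM0
  have hPz : a ^ c * (1 - z) ^ (2 - c) ≤ jacobiFlux c z := le_jacobiFlux hc hc2 ha.le ⟨hz.1, hz.2.le⟩
  have h1z : 0 < (1 - z) ^ (2 - c) := Real.rpow_pos_of_pos (by linarith [hz.2]) _
  have hPpos : 0 < jacobiFlux c z := jacobiFlux_pos c ⟨ha.trans_le hz.1, hz.2⟩
  -- `|y'(z)| ≤ n(n+1) M / ((2-c) a^c)`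
  have hder : |(derivative q).eval z| ≤ (n : ℝ) * (n + 1) * M / ((2 - c) * a ^ c) := by
    have e : (derivative q).eval z =
        ((n : ℝ) * (n + 1) * ∫ y in z..1, jacobiWeight c y * q.eval y) / jacobiFlux c z := by
      rw [← hPq]; field_simp
    rw [e, abs_div, abs_of_pos hPpos, div_le_div_iff₀ hPpos (by positivity), abs_mul,
      abs_of_nonneg (by positivity : (0 : ℝ) ≤ (n : ℝ) * (n + 1))]
    calc (n : ℝ) * (n + 1) * |∫ y in z..1, jacobiWeight c y * q.eval y| * ((2 - c) * a ^ c)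
          ≤ (n : ℝ) * (n + 1) * (M * ((1 - z) ^ (2 - c) / (2 - c))) * ((2 - c) * a ^ c) := by
            gcongr
      _ = (n : ℝ) * (n + 1) * M * (a ^ c * (1 - z) ^ (2 - c)) := by field_simp
      _ ≤ (n : ℝ) * (n + 1) * M * jacobiFlux c z := by gcongr
  -- square
  have hn : (n : ℝ) * (n + 1) ≤ ((n : ℝ) + 1) ^ 2 := by nlinarith
  have hsq := sq_le_sq' (abs_le.1 hder).1 (abs_le.1 hder).2
  calc ((derivative q).eval z) ^ 2
        ≤ ((n : ℝ) * (n + 1) * M / ((2 - c) * a ^ c)) ^ 2 := hsq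
    _ = ((n : ℝ) * (n + 1)) ^ 2 * M ^ 2 / ((2 - c) ^ 2 * (a ^ c) ^ 2) := by
        field_simp
    _ ≤ (((n : ℝ) + 1) ^ 2) ^ 2 * M ^ 2 / ((2 - c) ^ 2 * (a ^ c) ^ 2) := by
        gcongr
    _ = K / ((2 - c) ^ 2 * (a ^ c) ^ 2) * ((n : ℝ) + 1) ^ 6 * h := by
        rw [hM2]; field_simp

/-! ### The second-derivative bound on `[a, b]` -/

/-- **Second-derivative bound**: for `0 < a < b < 1` there is `K > 0` with
`y_n''(z)² ≤ K (n+1)⁶ h_n` for all `n` and all `z ∈ [a, b]` (from Euler's equation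
`z(1-z) y'' = -(c - 2z) y' - n(n+1) y`). [folklore] -/
theorem exists_sq_derivative_derivative_hypJacobi_le {a b : ℝ} (ha : 0 < a) (hab : a < b)
    (hb : b < 1) :
    ∃ K : ℝ, 0 < K ∧ ∀ n : ℕ, ∀ z ∈ Icc a b,
      ((derivative (derivative (hypJacobi c n))).eval z) ^ 2 ≤
        K * ((n : ℝ) + 1) ^ 6 * hypJacobiNormSq c n := by
  obtain ⟨K₀, hK₀, hsup⟩ := exists_sq_hypJacobi_le hc hc2 ha (hab.trans hb)
  obtain ⟨K₁, hK₁, hder⟩ := exists_sq_derivative_hypJacobi_le hc hc2 ha (hab.trans hb)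
  have hd : 0 < a * (1 - b) := mul_pos ha (by linarith)
  refine ⟨(8 * K₁ + 2 * K₀) / (a * (1 - b)) ^ 2, by positivity, fun n z hz => ?_⟩
  set q := hypJacobi c n with hq
  have hh := hypJacobiNormSq_pos hc hc2 n
  set h := hypJacobiNormSq c n
  have hck : ∀ k : ℕ, k < n → (k : ℝ) + c ≠ 0 := fun k _ => by positivity
  have hode := hypJacobi_ode_eval n hck z
  rw [← hq] at hode
  have hz1 : z ∈ Ico a 1 := ⟨hz.1, hz.2.trans_lt hb⟩
  have h0 := hsup n z ⟨hz.1, (hz.2.trans hb.le)⟩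
  have h1 := hder n z hz1
  -- `z(1-z) ≥ a(1-b)` on `[a, b]`
  have hzz : a * (1 - b) ≤ z * (1 - z) := by
    have : 0 ≤ 1 - z := by linarith [hz.2, hb]
    nlinarith [hz.1, hz.2, ha.le]
  have hcz : |c - 2 * z| ≤ 2 := by
    rw [abs_le]; constructor <;> nlinarith [hz.1, hz.2, ha, hb, hc, hc2]
  -- `|z(1-z) y''| ≤ 2|y'| + n(n+1)|y|`, squared
  have e : z * (1 - z) * (derivative (derivative q)).eval z =
      -((c - 2 * z) * (derivative q).eval z) - (n : ℝ) * (n + 1) * q.eval z := by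
    linear_combination hode
  have hn : (n : ℝ) * (n + 1) ≤ ((n : ℝ) + 1) ^ 2 := by nlinarith
  have hsq : (z * (1 - z) * (derivative (derivative q)).eval z) ^ 2 ≤
      8 * ((derivative q).eval z) ^ 2 + 2 * ((n : ℝ) * (n + 1)) ^ 2 * (q.eval z) ^ 2 := by
    rw [e]
    have hA : ((c - 2 * z) * (derivative q).eval z) ^ 2 ≤ 4 * ((derivative q).eval z) ^ 2 := by
      rw [mul_pow]
      have : (c - 2 * z) ^ 2 ≤ 4 := by nlinarith [abs_le.1 hcz]
      nlinarith [sq_nonneg ((derivative q).eval z)]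
    nlinarith [sq_nonneg ((c - 2 * z) * (derivative q).eval z - (n : ℝ) * (n + 1) * q.eval z)]
  have hlow : (a * (1 - b)) ^ 2 * ((derivative (derivative q)).eval z) ^ 2 ≤
      (z * (1 - z) * (derivative (derivative q)).eval z) ^ 2 := by
    rw [mul_pow (z * (1 - z))]
    exact mul_le_mul_of_nonneg_right (pow_le_pow_left₀ hd.le hzz 2) (sq_nonneg _)
  rw [div_mul_eq_mul_div, div_mul_eq_mul_div, le_div_iff₀ (by positivity)]
  have hn2 : ((n : ℝ) * (n + 1)) ^ 2 * ((n : ℝ) + 1) ^ 2 ≤ ((n : ℝ) + 1) ^ 6 := by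
    have := pow_le_pow_left₀ (by positivity) hn 2
    nlinarith
  calc ((derivative (derivative q)).eval z) ^ 2 * (a * (1 - b)) ^ 2
        = (a * (1 - b)) ^ 2 * ((derivative (derivative q)).eval z) ^ 2 := by ring
    _ ≤ 8 * ((derivative q).eval z) ^ 2 + 2 * ((n : ℝ) * (n + 1)) ^ 2 * (q.eval z) ^ 2 :=
        hlow.trans hsq
    _ ≤ 8 * (K₁ * ((n : ℝ) + 1) ^ 6 * h) + 2 * ((n : ℝ) * (n + 1)) ^ 2
          * (K₀ * ((n : ℝ) + 1) ^ 2 * h) := by gcongr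
    _ ≤ (8 * K₁ + 2 * K₀) * ((n : ℝ) + 1) ^ 6 * h := by
        nlinarith [mul_le_mul_of_nonneg_right hn2 (mul_nonneg hK₀.le hh.le)]

/-! ### The behaviour near `z = 0` -/

/-- `∫_z^1 1/P ≤ 6 z^{1-c}/(c-1)` for `z ∈ (0, 1/2]`: on `[z, 1/2]`, `1/P ≤ 2 y^{-c}`; on `[1/2, 1]`,
`1/P ≤ 4 (1-y)^{c-2}`; and `z^{1-c} ≥ 1`. [folklore] -/
theorem integral_inv_jacobiFlux_le {z : ℝ} (hz : z ∈ Ioc (0 : ℝ) (1 / 2)) :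
    ∫ y in z..1, (jacobiFlux c y)⁻¹ ≤ 6 * z ^ (1 - c) / (c - 1) := by
  have hc1 : 0 < c - 1 := by linarith
  have hz1 : z ≤ 1 := hz.2.trans (by norm_num)
  have hint := intervalIntegrable_inv_jacobiFlux hc hz.1 hz1
  have hI1 : IntervalIntegrable (fun y => (jacobiFlux c y)⁻¹) volume z (1 / 2) := by
    refine hint.mono_set ?_
    rw [uIcc_of_le hz.2, uIcc_of_le hz1]
    exact Icc_subset_Icc le_rfl (by norm_num)
  have hI2 : IntervalIntegrable (fun y => (jacobiFlux c y)⁻¹) volume (1 / 2) 1 := by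
    refine hint.mono_set ?_
    rw [uIcc_of_le (by norm_num : (1 : ℝ) / 2 ≤ 1), uIcc_of_le hz1]
    exact Icc_subset_Icc hz.2 le_rfl
  rw [← intervalIntegral.integral_add_adjacent_intervals hI1 hI2]
  have hzc : 1 ≤ z ^ (1 - c) :=
    Real.one_le_rpow_of_pos_of_le_one_of_nonpos hz.1 hz1 (by linarith)
  have h0notin : (0 : ℝ) ∉ uIcc z (1 / 2) := by
    rw [uIcc_of_le hz.2]; exact fun h => (lt_irrefl (0 : ℝ)) (hz.1.trans_le h.1)
  -- part 1: `∫_z^{1/2} 1/P ≤ 2 z^{1-c}/(c-1)`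
  have h1 : ∫ y in z..(1 / 2), (jacobiFlux c y)⁻¹ ≤ 2 * z ^ (1 - c) / (c - 1) := by
    have hrpow : IntervalIntegrable (fun y : ℝ => 2 * y ^ (-c)) volume z (1 / 2) :=
      (intervalIntegral.intervalIntegrable_rpow (r := -c) (Or.inr h0notin)).const_mul 2
    have hle : ∫ y in z..(1 / 2), (jacobiFlux c y)⁻¹ ≤ ∫ y in z..(1 / 2), 2 * y ^ (-c) := by
      refine intervalIntegral.integral_mono_on hz.2 hI1 hrpow fun y hy => ?_
      have hy0 : 0 < y := hz.1.trans_le hy.1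
      have hy1 : 0 < 1 - y := by linarith [hy.2]
      rw [jacobiFlux, mul_inv, ← Real.rpow_neg hy0.le, ← Real.rpow_neg hy1.le, mul_comm]
      refine mul_le_mul_of_nonneg_right ?_ (Real.rpow_nonneg hy0.le _)
      calc (1 - y) ^ (-(2 - c)) ≤ (1 / 2 : ℝ) ^ (-(2 - c)) :=
            Real.rpow_le_rpow_of_nonpos (by norm_num) (by linarith [hy.2]) (by linarith)
        _ ≤ (1 / 2 : ℝ) ^ (-1 : ℝ) :=
            Real.rpow_le_rpow_of_exponent_ge (by norm_num) (by norm_num) (by linarith)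
        _ = 2 := by norm_num
    have hval : ∫ y in z..(1 / 2), 2 * y ^ (-c) =
        2 * (((1 / 2 : ℝ) ^ (-c + 1) - z ^ (-c + 1)) / (-c + 1)) := by
      rw [intervalIntegral.integral_const_mul, integral_rpow (Or.inr ⟨by linarith, h0notin⟩)]
    rw [hval] at hle
    refine hle.trans ?_
    have hA : 0 ≤ (1 / 2 : ℝ) ^ (1 - c) := Real.rpow_nonneg (by norm_num) _
    have hc1' : (1 : ℝ) - c ≠ 0 := by linarith
    have hc1'' : c - 1 ≠ 0 := hc1.ne'
    have e : 2 * (((1 / 2 : ℝ) ^ (-c + 1) - z ^ (-c + 1)) / (-c + 1)) =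
        2 * (z ^ (1 - c) - (1 / 2 : ℝ) ^ (1 - c)) / (c - 1) := by
      rw [show -c + 1 = 1 - c by ring]
      field_simp
      ring
    rw [e]
    exact div_le_div_of_nonneg_right (by linarith) hc1.le
  -- part 2: `∫_{1/2}^1 1/P ≤ 4/(c-1)`
  have h2 : ∫ y in (1 / 2 : ℝ)..1, (jacobiFlux c y)⁻¹ ≤ 4 / (c - 1) := by
    have hrpow : IntervalIntegrable (fun y : ℝ => 4 * (1 - y) ^ (c - 2)) volume (1 / 2) 1 := by
      have h := (intervalIntegral.intervalIntegrable_rpow' (a := 1 / 2) (b := 0) (r := c - 2)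
        (by linarith)).comp_sub_left 1
      rw [show (1 : ℝ) - 1 / 2 = 1 / 2 by norm_num, sub_zero] at h
      exact h.const_mul 4
    have hle : ∫ y in (1 / 2 : ℝ)..1, (jacobiFlux c y)⁻¹ ≤
        ∫ y in (1 / 2 : ℝ)..1, 4 * (1 - y) ^ (c - 2) := by
      refine intervalIntegral.integral_mono_on_of_le_Ioo (by norm_num) hI2 hrpow fun y hy => ?_
      have hy0 : 0 < y := by linarith [hy.1]
      have hy1 : 0 < 1 - y := by linarith [hy.2]
      rw [jacobiFlux, mul_inv, ← Real.rpow_neg hy1.le, neg_sub]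
      refine mul_le_mul_of_nonneg_right ?_ (Real.rpow_nonneg hy1.le _)
      -- `y^{-c} ≤ 4` for `y ∈ [1/2, 1]`
      have hyc : y ^ (2 : ℝ) ≤ y ^ c :=
        Real.rpow_le_rpow_of_exponent_ge hy0 hy.2.le hc2.le
      rw [Real.rpow_two] at hyc
      have hy2 : (1 / 4 : ℝ) ≤ y ^ 2 := by nlinarith [hy.1]
      have hyc' : 0 < y ^ c := Real.rpow_pos_of_pos hy0 _
      rw [inv_le_comm₀ hyc' (by norm_num)]
      linarith
    refine hle.trans ?_
    rw [intervalIntegral.integral_const_mul,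
      intervalIntegral.integral_comp_sub_left (fun y : ℝ => y ^ (c - 2)) 1, sub_self,
      show (1 : ℝ) - 1 / 2 = 1 / 2 by norm_num, integral_rpow (Or.inl (by linarith)),
      show c - 2 + 1 = c - 1 by ring, Real.zero_rpow hc1.ne', sub_zero]
    have hhalf : (1 / 2 : ℝ) ^ (c - 1) ≤ 1 := Real.rpow_le_one (by norm_num) (by norm_num) hc1.le
    have hdiv : (1 / 2 : ℝ) ^ (c - 1) / (c - 1) ≤ 1 / (c - 1) :=
      div_le_div_of_nonneg_right hhalf hc1.le
    rw [div_eq_mul_one_div 4 (c - 1)]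
    exact mul_le_mul_of_nonneg_left hdiv (by norm_num)
  -- combine
  have h3 : 4 / (c - 1) ≤ 4 * z ^ (1 - c) / (c - 1) :=
    div_le_div_of_nonneg_right (by nlinarith) hc1.le
  have : 2 * z ^ (1 - c) / (c - 1) + 4 * z ^ (1 - c) / (c - 1) = 6 * z ^ (1 - c) / (c - 1) := by
    ring
  linarith

/-- **Bound near `z = 0`**: there is `K > 0` (depending on `c`) with
`y_n(z)² ≤ K (n+1)² h_n · z^{1-c}` for all `n` and `z ∈ (0, 1/2]` — so `z^{c-1} y_n(z)²`, and a
fortiori the Dirichlet branch `z^{(c-1)} |Σ …|` with the extra factor `z^{(c-1)/2}`, is controlled at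
`z = 0`. [folklore] -/
theorem exists_sq_hypJacobi_le_near_zero :
    ∃ K : ℝ, 0 < K ∧ ∀ n : ℕ, ∀ z ∈ Ioc (0 : ℝ) (1 / 2),
      ((hypJacobi c n).eval z) ^ 2 ≤ K * ((n : ℝ) + 1) ^ 2 * hypJacobiNormSq c n * z ^ (1 - c) := by
  obtain ⟨K₀, hK₀, hsup⟩ := exists_sq_hypJacobi_le hc hc2 (a := 1 / 2) (by norm_num) (by norm_num)
  have hc1 : 0 < c - 1 := by linarith
  refine ⟨12 / (c - 1) + 2 * K₀, by positivity, fun n z hz => ?_⟩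
  have hh := hypJacobiNormSq_pos hc hc2 n
  set h := hypJacobiNormSq c n
  have hz1 : z ≤ 1 := hz.2.trans (by norm_num)
  have hzc : 1 ≤ z ^ (1 - c) :=
    Real.one_le_rpow_of_pos_of_le_one_of_nonpos hz.1 hz1 (by linarith)
  -- increment from `z` to `1/2`
  have hincr := sq_hypJacobi_sub_le hc hc2 hz.1 n le_rfl hz.2 (by norm_num : (1 : ℝ) / 2 < 1)
  have hI := integral_inv_jacobiFlux_le hc hc2 hz
  have hmid := hsup n (1 / 2) ⟨le_rfl, by norm_num⟩
  have hn : (n : ℝ) * (n + 1) ≤ ((n : ℝ) + 1) ^ 2 := by nlinarith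
  have e : (hypJacobi c n).eval z =
      (hypJacobi c n).eval (1 / 2) - ((hypJacobi c n).eval (1 / 2) - (hypJacobi c n).eval z) := by
    ring
  have hsq : ((hypJacobi c n).eval z) ^ 2 ≤ 2 * ((hypJacobi c n).eval (1 / 2)) ^ 2
      + 2 * ((hypJacobi c n).eval (1 / 2) - (hypJacobi c n).eval z) ^ 2 := by
    rw [e]
    nlinarith [sq_nonneg ((hypJacobi c n).eval (1 / 2)
      + ((hypJacobi c n).eval (1 / 2) - (hypJacobi c n).eval z))]
  have hA : ((hypJacobi c n).eval (1 / 2)) ^ 2 ≤ K₀ * ((n : ℝ) + 1) ^ 2 * h * z ^ (1 - c) := by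
    refine hmid.trans ?_
    have : 0 ≤ K₀ * ((n : ℝ) + 1) ^ 2 * h := by positivity
    nlinarith
  have hB : ((hypJacobi c n).eval (1 / 2) - (hypJacobi c n).eval z) ^ 2 ≤
      6 / (c - 1) * ((n : ℝ) + 1) ^ 2 * h * z ^ (1 - c) := by
    refine hincr.trans ?_
    have h0 : 0 ≤ (n : ℝ) * (n + 1) * h := by positivity
    calc (n : ℝ) * (n + 1) * h * ∫ y in z..1, (jacobiFlux c y)⁻¹
          ≤ (n : ℝ) * (n + 1) * h * (6 * z ^ (1 - c) / (c - 1)) :=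
            mul_le_mul_of_nonneg_left hI h0
      _ ≤ ((n : ℝ) + 1) ^ 2 * h * (6 * z ^ (1 - c) / (c - 1)) := by
            have : 0 ≤ 6 * z ^ (1 - c) / (c - 1) := by positivity
            exact mul_le_mul_of_nonneg_right (mul_le_mul_of_nonneg_right hn hh.le) this
      _ = 6 / (c - 1) * ((n : ℝ) + 1) ^ 2 * h * z ^ (1 - c) := by field_simp
  calc ((hypJacobi c n).eval z) ^ 2
        ≤ 2 * (K₀ * ((n : ℝ) + 1) ^ 2 * h * z ^ (1 - c))
          + 2 * (6 / (c - 1) * ((n : ℝ) + 1) ^ 2 * h * z ^ (1 - c)) := by linarith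
    _ = (12 / (c - 1) + 2 * K₀) * ((n : ℝ) + 1) ^ 2 * h * z ^ (1 - c) := by ring

end Bounds

end Literature.Analysis.SpecialFunctions
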